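import Summits.AnomalousDissipation.AnomalousDissipation.Theorems.SawtoothPulseCascadeK1LocalisedCascadeKoopmanLeakage

/-!
# K1loc, line `Spectral` / SeqCone — helper: KOOPMAN LEAKAGE FOR ALL SMOOTH FUNCTIONS (band limitation removed)

Helper file of the first prover lane on the crux `K1LocalisedCascade` (stmt-AnomalousDissipation-19491), route
`SawtoothPulseCascade`, completing `…KoopmanLeakage` (`sqrt_tsum_symbol_sq_comp_shearMap_le_of_band`, band-limited `θ`):
the inviscid Egorov step for a transversal shear `Φ = Torus.shearMap i j P` (`i ≠ j`) holds for EVERY smooth `θ`,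

  `√(∑ₖ m_k² ‖𝓕(θ∘Φ)(k)‖²) ≤ √(∑ₖ m_k² ‖𝓕θ(k)‖²) + A·√(∫‖θ‖²)`,

as soon as the fibre multipliers `g_n(x_j)` (`n ∈ ℤ`) have a uniform `ω`-moment bound `A`.  The passage from band-limited
to general `θ` needs NO limit: the shear preserves fibres (`Torus.mFourierCoeff_comp_shearMap`), so on the modes with
`|k_i| ≤ N` the transport of `θ` and of its truncation `θ_N` (the spectral piece on `{|k_i| ≤ N}`, `Torus.modePiece`) have
the SAME coefficients; every finite partial sum of the left side is therefore a partial sum for some `θ_N`, bounded by the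
band-limited lemma and by `‖m(D)θ_N‖ ≤ ‖m(D)θ‖`, `‖θ_N‖ ≤ ‖θ‖`.

* `mFourierCoeff_comp_shearMap_modePiece_eq` — fibre locality of the transport: for `|k_i| ≤ N`,
  `𝓕(θ_N ∘ Φ)(k) = 𝓕(θ ∘ Φ)(k)`;
* `sqrt_tsum_symbol_sq_comp_shearMap_le` — the general statement.

WHAT THIS IS NOT: no statement about the cascade scalar.  [cite: Grafakos2014, Prop. 3.1.2 (5) and Prop. 3.2.7 (3)] [problem: turb]
-/

-- `Summit.<Summit>.<Problem>`: single-conjunct summit, the duplicate namespace segment is deliberate.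
set_option linter.dupNamespace false

noncomputable section

namespace Summit.AnomalousDissipation.AnomalousDissipation.Theorems.SawtoothPulseCascade.SpectralLeakage

open MeasureTheory Set Filter Topology UnitAddTorus Complex
open Literature.Analysis Literature.Analysis.FunctionSpaces Literature.Analysis.FluidPDE
open Literature.Analysis.FunctionSpaces.Torus

variable {d : Type*} [Fintype d] [DecidableEq d]

/-- **Fibre locality of the shear transport.**  For a smooth `θ`, its spectral piece `θ_N` on the band `{|k_i| ≤ N}` and a
transversal shear `Φ = shearMap i j P` (`i ≠ j`): `𝓕(θ_N ∘ Φ)(k) = 𝓕(θ ∘ Φ)(k)` for every mode with `|k_i| ≤ N` (the shear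
moves coefficients only along `eⱼ`, `Torus.mFourierCoeff_comp_shearMap`). [folklore] -/
theorem mFourierCoeff_comp_shearMap_modePiece_eq {θ : UnitAddTorus d → ℂ} {i j : d} (hθ : IsSmooth θ) (hij : i ≠ j)
    (P : ShearProfile) (N : ℕ) {k : d → ℤ} (hk : |k i| ≤ (N : ℤ)) :
    mFourierCoeff (modePiece {k : d → ℤ | |k i| ≤ (N : ℤ)} θ ∘ shearMap i j P) k =
      mFourierCoeff (θ ∘ shearMap i j P) k := by
  have hN := isSmooth_modePiece hθ {k : d → ℤ | |k i| ≤ (N : ℤ)}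
  rw [mFourierCoeff_comp_shearMap hN.continuous hN.rapidDecay_mFourierCoeff.summable_norm hij P k,
    mFourierCoeff_comp_shearMap hθ.continuous hθ.rapidDecay_mFourierCoeff.summable_norm hij P k]
  refine tsum_congr fun q => ?_
  rw [mFourierCoeff_modePiece hθ, Set.indicator_of_mem]
  simp only [Set.mem_setOf_eq, Pi.sub_apply, Pi.single_eq_of_ne hij, sub_zero]
  exact hk

/-- **Koopman leakage for every smooth function.**  Let `θ : T^d → ℂ` be smooth, `Φ = shearMap i j P` a transversal shear
(`i ≠ j`), `m` a real symbol with `|m| ≤ M` and modulus `ω ≥ 0`, and suppose ALL fibre multipliers `Θ_n(x) = g_n(x_j)`,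
`n ∈ ℤ`, have summable coefficients with `∑_q ω q ‖𝓕Θ_n q‖ ≤ A`.  Then
`√(∑ₖ m_k²‖𝓕(θ∘Φ) k‖²) ≤ √(∑ₖ m_k²‖𝓕θ k‖²) + A √(∫‖θ‖²)`.
[cite: Grafakos2014, Prop. 3.1.2 (5) (coefficients of products) and Prop. 3.2.7 (3) (Parseval)] -/
theorem sqrt_tsum_symbol_sq_comp_shearMap_le {θ : UnitAddTorus d → ℂ} {i j : d} (hθ : IsSmooth θ) (hij : i ≠ j)
    (P : ShearProfile) {m : (d → ℤ) → ℝ} {M : ℝ} (hmM : ∀ k, |m k| ≤ M) {ω : (d → ℤ) → ℝ} (hω0 : ∀ q, 0 ≤ ω q)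
    (hω : ∀ k q, |m k - m (k - q)| ≤ ω q)
    (hΘs : ∀ n : ℤ, Summable fun q => ‖mFourierCoeff (fun x : UnitAddTorus d => twist P n (x j)) q‖)
    (hωs : ∀ n : ℤ, Summable fun q => ω q * ‖mFourierCoeff (fun x : UnitAddTorus d => twist P n (x j)) q‖)
    {A : ℝ} (hA0 : 0 ≤ A)
    (hA : ∀ n : ℤ, ∑' q, ω q * ‖mFourierCoeff (fun x : UnitAddTorus d => twist P n (x j)) q‖ ≤ A) :
    Real.sqrt (∑' k, m k ^ 2 * ‖mFourierCoeff (θ ∘ shearMap i j P) k‖ ^ 2) ≤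
      Real.sqrt (∑' k, m k ^ 2 * ‖mFourierCoeff θ k‖ ^ 2) + A * Real.sqrt (∫ x, ‖θ x‖ ^ 2) := by
  classical
  have hM0 : 0 ≤ M := (abs_nonneg _).trans (hmM 0)
  have hm2 : ∀ k, m k ^ 2 ≤ M ^ 2 := fun k => by
    rw [← sq_abs]; exact pow_le_pow_left₀ (abs_nonneg _) (hmM k) 2
  -- the right-hand side `R` and the weighted families
  set R : ℝ := Real.sqrt (∑' k, m k ^ 2 * ‖mFourierCoeff θ k‖ ^ 2) + A * Real.sqrt (∫ x, ‖θ x‖ ^ 2) with hR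
  have hR0 : 0 ≤ R := add_nonneg (Real.sqrt_nonneg _) (mul_nonneg hA0 (Real.sqrt_nonneg _))
  have hParsθ := hasSum_sq_mFourierCoeff_of_continuous hθ.continuous
  have hcomp_c : Continuous (θ ∘ shearMap i j P) := (hθ.comp_shearMap i j P).continuous
  have hParsΦ := hasSum_sq_mFourierCoeff_of_continuous hcomp_c
  have hwθ : Summable fun k => m k ^ 2 * ‖mFourierCoeff θ k‖ ^ 2 :=
    (hParsθ.summable.mul_left (M ^ 2)).of_nonneg_of_le (fun k => by positivity)
      fun k => mul_le_mul_of_nonneg_right (hm2 k) (sq_nonneg _)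
  have hwΦ : Summable fun k => m k ^ 2 * ‖mFourierCoeff (θ ∘ shearMap i j P) k‖ ^ 2 :=
    (hParsΦ.summable.mul_left (M ^ 2)).of_nonneg_of_le (fun k => by positivity)
      fun k => mul_le_mul_of_nonneg_right (hm2 k) (sq_nonneg _)
  -- every finite partial sum of the left side is bounded by `R²`
  have hfin : ∀ T : Finset (d → ℤ), ∑ k ∈ T, m k ^ 2 * ‖mFourierCoeff (θ ∘ shearMap i j P) k‖ ^ 2 ≤ R ^ 2 := by
    intro T
    -- a band containing `T`
    obtain ⟨N, hN⟩ : ∃ N : ℕ, ∀ k ∈ T, |k i| ≤ (N : ℤ) := by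
      refine ⟨T.sup fun k => (k i).natAbs, fun k hk => ?_⟩
      have h1 : (k i).natAbs ≤ T.sup fun k => (k i).natAbs := Finset.le_sup (f := fun k => (k i).natAbs) hk
      calc |k i| = ((k i).natAbs : ℤ) := (Int.natCast_natAbs (k i)).symm
        _ ≤ _ := by exact_mod_cast h1
    set B : Set (d → ℤ) := {k : d → ℤ | |k i| ≤ (N : ℤ)} with hB
    set θN : UnitAddTorus d → ℂ := modePiece B θ with hθN
    have hθN_smooth : IsSmooth θN := isSmooth_modePiece hθ B
    have hθN_coeff : ∀ k, mFourierCoeff θN k = B.indicator (mFourierCoeff θ) k := mFourierCoeff_modePiece hθ B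
    have hband : ∀ k, mFourierCoeff θN k ≠ 0 → k i ∈ Finset.Icc (-(N : ℤ)) N := by
      intro k hk
      rw [hθN_coeff] at hk
      have hkB : k ∈ B := by
        by_contra h; exact hk (Set.indicator_of_notMem h _)
      rw [Finset.mem_Icc]
      exact abs_le.mp hkB
    -- the band-limited lemma for `θN`
    have hBL := sqrt_tsum_symbol_sq_comp_shearMap_le_of_band hθN_smooth hij (Finset.Icc (-(N : ℤ)) N) hband P hmM
      hω0 hω (fun n _ => hΘs n) (fun n _ => hωs n) hA0 (fun n _ => hA n)
    -- `‖m(D)θN‖ ≤ ‖m(D)θ‖` and `‖θN‖ ≤ ‖θ‖`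
    have hcoeff_le : ∀ k, ‖mFourierCoeff θN k‖ ^ 2 ≤ ‖mFourierCoeff θ k‖ ^ 2 := fun k => by
      rw [hθN_coeff, norm_indicator_eq_indicator_norm]
      exact pow_le_pow_left₀ (Set.indicator_nonneg (fun _ _ => norm_nonneg _) k)
        (Set.indicator_le_self' (fun _ _ => norm_nonneg _) k) 2
    have hParsN := hasSum_sq_mFourierCoeff_of_continuous hθN_smooth.continuous
    have h1 : ∑' k, m k ^ 2 * ‖mFourierCoeff θN k‖ ^ 2 ≤ ∑' k, m k ^ 2 * ‖mFourierCoeff θ k‖ ^ 2 :=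
      Summable.tsum_le_tsum (fun k => mul_le_mul_of_nonneg_left (hcoeff_le k) (sq_nonneg _))
        ((hParsN.summable.mul_left (M ^ 2)).of_nonneg_of_le (fun k => by positivity)
          fun k => mul_le_mul_of_nonneg_right (hm2 k) (sq_nonneg _)) hwθ
    have h2 : ∫ x, ‖θN x‖ ^ 2 ≤ ∫ x, ‖θ x‖ ^ 2 := by
      rw [← hParsN.tsum_eq, ← hParsθ.tsum_eq]
      exact hParsN.summable.tsum_le_tsum hcoeff_le hParsθ.summable
    have hBL' : Real.sqrt (∑' k, m k ^ 2 * ‖mFourierCoeff (θN ∘ shearMap i j P) k‖ ^ 2) ≤ R :=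
      hBL.trans (add_le_add (Real.sqrt_le_sqrt h1) (mul_le_mul_of_nonneg_left (Real.sqrt_le_sqrt h2) hA0))
    -- the partial sum over `T` is a partial sum for `θN`
    have hwN : Summable fun k => m k ^ 2 * ‖mFourierCoeff (θN ∘ shearMap i j P) k‖ ^ 2 :=
      ((hasSum_sq_mFourierCoeff_of_continuous (hθN_smooth.comp_shearMap i j P).continuous).summable.mul_left
        (M ^ 2)).of_nonneg_of_le (fun k => by positivity) fun k => mul_le_mul_of_nonneg_right (hm2 k) (sq_nonneg _)
    have hT : ∑ k ∈ T, m k ^ 2 * ‖mFourierCoeff (θ ∘ shearMap i j P) k‖ ^ 2 =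
        ∑ k ∈ T, m k ^ 2 * ‖mFourierCoeff (θN ∘ shearMap i j P) k‖ ^ 2 :=
      Finset.sum_congr rfl fun k hk => by rw [mFourierCoeff_comp_shearMap_modePiece_eq hθ hij P N (hN k hk)]
    have h0 : 0 ≤ ∑' k, m k ^ 2 * ‖mFourierCoeff (θN ∘ shearMap i j P) k‖ ^ 2 := tsum_nonneg fun k => by positivity
    calc ∑ k ∈ T, m k ^ 2 * ‖mFourierCoeff (θ ∘ shearMap i j P) k‖ ^ 2
        = ∑ k ∈ T, m k ^ 2 * ‖mFourierCoeff (θN ∘ shearMap i j P) k‖ ^ 2 := hT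
      _ ≤ ∑' k, m k ^ 2 * ‖mFourierCoeff (θN ∘ shearMap i j P) k‖ ^ 2 :=
          hwN.sum_le_tsum T fun k _ => by positivity
      _ = (Real.sqrt (∑' k, m k ^ 2 * ‖mFourierCoeff (θN ∘ shearMap i j P) k‖ ^ 2)) ^ 2 := (Real.sq_sqrt h0).symm
      _ ≤ R ^ 2 := pow_le_pow_left₀ (Real.sqrt_nonneg _) hBL' 2
  -- pass to the full sum and take square roots
  have htsum : ∑' k, m k ^ 2 * ‖mFourierCoeff (θ ∘ shearMap i j P) k‖ ^ 2 ≤ R ^ 2 := hwΦ.tsum_le_of_sum_le hfin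
  calc Real.sqrt (∑' k, m k ^ 2 * ‖mFourierCoeff (θ ∘ shearMap i j P) k‖ ^ 2) ≤ Real.sqrt (R ^ 2) :=
        Real.sqrt_le_sqrt htsum
    _ = R := Real.sqrt_sq hR0

end Summit.AnomalousDissipation.AnomalousDissipation.Theorems.SawtoothPulseCascade.SpectralLeakage
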